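import Summits.KontsevichZagierPeriods.KontsevichZagierPeriods.Theorems.RootDecompWalshStrataHtypeConicLinear

/-!
# Root decomposition (Walsh strata), part 59 — H-type XIV: the terminal `P/((x − ρ)H²)·√E₁`

Tool for the last conic-edge sub-family (perfect-square radicand, part 60).  For `P ∈ ℚ[X]` of degree
`≤ 6`, `H = eX² + g` with `e, g > 0`, `E₁ > 0` and a domain inside `[0, 1] ∖ {ρ}`, the integrand
`P(x)/((x − ρ)H(x)²)·√E₁` is in the Baker sector (`InBaker.of_pole_H2`): the RESIDUE SPLIT
`P/((X − ρ)H²) = A/(X − ρ) + W/H²` (`A = P(ρ)/H(ρ)²`, `W = (P − AH²)/(X − ρ)` by `divByMonic`, §59.1),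
the residue handled by the LANDED `sqrt_const_pole`, and the PARITY SPLIT `W(x) = We(x²) + x·Wo(x²)`
(`deg W ≤ 5`, via `as_sum_range_C_mul_X_pow'`), the even part by the LANDED `sqrt_const_even`, the odd
part by `of_Hodd_chart` (part 57); the three pieces are glued by `of_sub'` with bounded representations.

References: [KontsevichZagier2001 §1.2 rules (1)–(3)], [BCR1998 §2.2].
-/

noncomputable section

open Set MeasureTheory MvPolynomial Literature.NumberTheory.Transcendental
open Literature.ModelTheory.ExponentialFields (IsSemialgebraic isSemialgebraic_univ isSemialgebraic_empty)
open Summit.KontsevichZagierPeriods.RootDecompWalshStrata.ConicDescent.VertexChart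

namespace Summit.KontsevichZagierPeriods.RootDecompWalshStrata.ConicDescent.BallCube

/-! #### 59.1 Residue split of `P/((X − ρ)·H²)` and the parity split of the regular part -/

/-- The regular part `W = (P − A·H²)/(X − ρ)`, `A = P(ρ)/H(ρ)²`, of `P/((X − ρ)H²) = A/(X − ρ) + W/H²`.
[bookkeeping] -/
def hResW (P : Polynomial ℚ) (e g ρ : ℚ) : Polynomial ℚ :=
  (P - Polynomial.C (P.eval ρ / (hP e g).eval ρ ^ 2) * hP e g ^ 2) /ₘ (Polynomial.X - Polynomial.C ρ)

/-- `(X − ρ)·W = P − A·H²`. [bookkeeping] -/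
theorem hResW_mul (P : Polynomial ℚ) (e g ρ : ℚ) (hH : (hP e g).eval ρ ≠ 0) :
    (Polynomial.X - Polynomial.C ρ) * hResW P e g ρ =
      P - Polynomial.C (P.eval ρ / (hP e g).eval ρ ^ 2) * hP e g ^ 2 := by
  rw [hResW, Polynomial.mul_divByMonic_eq_iff_isRoot, Polynomial.IsRoot, Polynomial.eval_sub,
    Polynomial.eval_mul, Polynomial.eval_C, Polynomial.eval_pow, div_mul_cancel₀ _ (pow_ne_zero 2 hH),
    sub_self]

/-- `(x − ρ)·W(x) = P(x) − A·H(x)²` over `ℝ`. [bookkeeping] -/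
theorem aeval_hResW (P : Polynomial ℚ) (e g ρ : ℚ) (hH : (hP e g).eval ρ ≠ 0) (x : ℝ) :
    (x - ρ) * Polynomial.aeval x (hResW P e g ρ) =
      Polynomial.aeval x P - (P.eval ρ / (hP e g).eval ρ ^ 2 : ℚ) * ((e : ℝ) * x ^ 2 + g) ^ 2 := by
  have h := congrArg (Polynomial.aeval x) (hResW_mul P e g ρ hH)
  simp only [map_mul, map_sub, map_pow, Polynomial.aeval_X, Polynomial.aeval_C, eq_ratCast,
    aeval_hP] at h
  exact h

/-- `deg W ≤ 5` when `deg P ≤ 6`. [bookkeeping] -/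
theorem natDegree_hResW_le (P : Polynomial ℚ) (e g ρ : ℚ) (h6 : P.natDegree ≤ 6) :
    (hResW P e g ρ).natDegree ≤ 5 := by
  rw [hResW, Polynomial.natDegree_divByMonic _ (Polynomial.monic_X_sub_C ρ),
    Polynomial.natDegree_X_sub_C]
  have h2 : (P - Polynomial.C (P.eval ρ / (hP e g).eval ρ ^ 2) * hP e g ^ 2).natDegree ≤ 6 := by
    refine (Polynomial.natDegree_sub_le _ _).trans (max_le h6 ?_)
    unfold hP
    compute_degree!
  omega

/-- Even part (in `u = x²`) of a polynomial of degree `≤ 5`. [bookkeeping] -/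
def hEv3 (W : Polynomial ℚ) : Polynomial ℚ :=
  Polynomial.C (W.coeff 0) + Polynomial.C (W.coeff 2) * Polynomial.X +
    Polynomial.C (W.coeff 4) * Polynomial.X ^ 2

/-- `We(u) = w₀ + w₂u + w₄u²`. [bookkeeping] -/
theorem aeval_hEv3 (W : Polynomial ℚ) (u : ℝ) : Polynomial.aeval u (hEv3 W) =
    (W.coeff 0 : ℝ) + (W.coeff 2 : ℝ) * u + (W.coeff 4 : ℝ) * u ^ 2 := by
  simp [hEv3]

/-- Parity split `W(x) = We(x²) + x·(w₅x⁴ + w₃x² + w₁)` for `deg W ≤ 5`. [bookkeeping] -/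
theorem aeval_parity5 (W : Polynomial ℚ) (hW : W.natDegree ≤ 5) (x : ℝ) :
    Polynomial.aeval x W = Polynomial.aeval (x ^ 2) (hEv3 W) +
      x * ((W.coeff 5 : ℝ) * x ^ 4 + (W.coeff 3 : ℝ) * x ^ 2 + (W.coeff 1 : ℝ)) := by
  have h := Polynomial.as_sum_range_C_mul_X_pow' W (show W.natDegree < 6 by omega)
  conv_lhs => rw [h]
  simp only [Finset.sum_range_succ, Finset.sum_range_zero, map_add, map_zero, map_mul, map_pow,
    Polynomial.aeval_X, Polynomial.aeval_C, eq_ratCast, aeval_hEv3]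
  ring

/-- `|w₀ + w₂u + w₄u²| ≤ |w₀| + |w₂| + |w₄|` on `0 ≤ u ≤ 1`. [bookkeeping] -/
theorem abs_quad_le (a b c : ℚ) (u : ℝ) (hu0 : 0 ≤ u) (hu1 : u ≤ 1) :
    |(a : ℝ) + (b : ℝ) * u + (c : ℝ) * u ^ 2| ≤ |(a : ℝ)| + |(b : ℝ)| + |(c : ℝ)| := by
  have h1 : |(b : ℝ) * u| ≤ |(b : ℝ)| := by
    rw [abs_mul, abs_of_nonneg hu0]; exact mul_le_of_le_one_right (abs_nonneg _) hu1
  have h2 : |(c : ℝ) * u ^ 2| ≤ |(c : ℝ)| := by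
    rw [abs_mul, abs_of_nonneg (pow_nonneg hu0 2)]
    exact mul_le_of_le_one_right (abs_nonneg _) (by nlinarith)
  linarith [abs_add_three (a : ℝ) ((b : ℝ) * u) ((c : ℝ) * u ^ 2)]

/-- `deg (c · hCxNB) ≤ 6`. [bookkeeping] -/
theorem natDegree_C_mul_hCxNB_le (c e g m γ q0 q1 q2 : ℚ) :
    (Polynomial.C c * hCxNB e g m γ q0 q1 q2).natDegree ≤ 6 := by
  unfold hCxNB hPi hP
  compute_degree!

/-- Odd part `X·(w₅X⁴ + w₃X² + w₁)` of a polynomial of degree `≤ 5`. [bookkeeping] -/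
def hOd3 (W : Polynomial ℚ) : Polynomial ℚ :=
  Polynomial.X * (Polynomial.C (W.coeff 5) * Polynomial.X ^ 4 + Polynomial.C (W.coeff 3) * Polynomial.X ^ 2 +
    Polynomial.C (W.coeff 1))

/-- `Wo-part(x) = x (w₅x⁴ + w₃x² + w₁)`. [bookkeeping] -/
theorem aeval_hOd3 (W : Polynomial ℚ) (x : ℝ) : Polynomial.aeval x (hOd3 W) =
    x * ((W.coeff 5 : ℝ) * x ^ 4 + (W.coeff 3 : ℝ) * x ^ 2 + (W.coeff 1 : ℝ)) := by
  simp [hOd3]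

/-! #### 59.2 The terminal `P/((x − ρ)·H²)·√E₁` -/

/-- **Simple rational pole times `√E₁` over `H²`.**  For `deg P ≤ 6`, `e, g, E₁ > 0` and a domain inside
`[0, 1] ∖ {ρ}`, `P(x)/((x − ρ)H(x)²)·√E₁` is in the Baker sector: the residue `A/(x − ρ)·√E₁`
(`A = P(ρ)/H(ρ)²`, LANDED `sqrt_const_pole`), the even regular part `We(x²)/H²·√E₁` (LANDED
`sqrt_const_even`) and the odd regular part (`of_Hodd_chart`, part 57), glued by `of_sub'`.
[KontsevichZagier2001 §1.2 rules (1)–(3); this node] -/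
theorem InBaker.of_pole_H2 (E1 ρ e g : ℚ) (P : Polynomial ℚ) (h6 : P.natDegree ≤ 6) (hE1 : 0 < E1)
    (he : 0 < e) (hg : 0 < g) (r : KZ.IntegralRep 1)
    (hdom : ∀ v ∈ r.domain, (0 ≤ v 0 ∧ v 0 ≤ 1) ∧ v 0 ≠ (ρ : ℝ))
    (hri : EqOn r.integrand (fun t => Polynomial.aeval (t 0) P / ((t 0 - ρ) * ((e : ℝ) * t 0 ^ 2 + g) ^ 2) *
      √(qD 0 0 E1 (t 0))) r.domain) :
    InBaker (KZ.of r) := by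
  have he0 : (0 : ℝ) < e := by exact_mod_cast he
  have hg0 : (0 : ℝ) < g := by exact_mod_cast hg
  have hE10 : (0 : ℝ) < E1 := by exact_mod_cast hE1
  have hH : ∀ x : ℝ, 0 < (e : ℝ) * x ^ 2 + g := fun x => by positivity
  have hqD : ∀ y : ℝ, qD 0 0 E1 y = E1 := fun y => by simp [qD]
  have hHρ : (hP e g).eval ρ ≠ 0 := by
    have h1 : 0 < (hP e g).eval ρ := by
      simp only [hP, Polynomial.eval_add, Polynomial.eval_mul, Polynomial.eval_C, Polynomial.eval_pow,
        Polynomial.eval_X]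
      positivity
    exact h1.ne'
  obtain ⟨A, hA⟩ : ∃ A : ℚ, A = P.eval ρ / (hP e g).eval ρ ^ 2 := ⟨_, rfl⟩
  obtain ⟨W, hW⟩ : ∃ W : Polynomial ℚ, W = hResW P e g ρ := ⟨_, rfl⟩
  have hW5 : W.natDegree ≤ 5 := hW ▸ natDegree_hResW_le P e g ρ h6
  have hkey : ∀ x : ℝ, Polynomial.aeval x P =
      (A : ℝ) * ((e : ℝ) * x ^ 2 + g) ^ 2 + (x - ρ) * Polynomial.aeval x W := fun x => by
    have h := aeval_hResW P e g ρ hHρ x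
    rw [← hW, ← hA] at h
    linarith
  have hb : Bornology.IsBounded r.domain := by
    refine isBounded_iff_forall_norm_le.2 ⟨1, fun t ht => ?_⟩
    refine (pi_norm_le_iff_of_nonneg zero_le_one).2 fun i => ?_
    rw [Fin.eq_zero i, Real.norm_eq_abs, abs_le]
    exact ⟨by linarith [(hdom t ht).1.1], (hdom t ht).1.2⟩
  -- the even regular part, as a bounded representation on `r.domain`
  have hQne : ∀ v ∈ r.domain, Polynomial.aeval (v 0 ^ 2) (hHu e g ^ 2) ≠ 0 := fun v _ => by
    rw [map_pow, aeval_hHu]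
    exact pow_ne_zero 2 (hH (v 0)).ne'
  have hfE : IsSemialgebraicFunOn ℚ r.domain fun v =>
      Polynomial.aeval (v 0 ^ 2) (hEv3 W) / Polynomial.aeval (v 0 ^ 2) (hHu e g ^ 2) *
        √(qD 0 0 E1 (v 0)) :=
    (((((IsRatOn.coord.pow 2).polyAeval (hEv3 W)).div
      ((IsRatOn.coord.pow 2).polyAeval (hHu e g ^ 2)) hQne).isSemialgebraicFunOn
        r.isSemialgebraic_domain).mul_holds (IsSemialgebraicFunOn.sqrt_holds
          (isSemialgebraicFunOn_qD 0 0 E1 r.isSemialgebraic_domain))).congr fun t _ => by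
      simp only [Pi.mul_apply]
  have hME : ∀ v ∈ r.domain,
      |Polynomial.aeval (v 0 ^ 2) (hEv3 W) / Polynomial.aeval (v 0 ^ 2) (hHu e g ^ 2) *
        √(qD 0 0 E1 (v 0))| ≤
        (|(W.coeff 0 : ℝ)| + |(W.coeff 2 : ℝ)| + |(W.coeff 4 : ℝ)|) / (g : ℝ) ^ 2 * √(E1 : ℝ) := by
    intro v hv
    obtain ⟨⟨hx0, hx1⟩, -⟩ := hdom v hv
    have hHv := hH (v 0)
    have hx2 : v 0 ^ 2 ≤ 1 := by nlinarith
    have hnum := abs_quad_le (W.coeff 0) (W.coeff 2) (W.coeff 4) (v 0 ^ 2) (sq_nonneg _) hx2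
    have hden : (g : ℝ) ^ 2 ≤ ((e : ℝ) * v 0 ^ 2 + g) ^ 2 := by
      nlinarith [mul_nonneg he0.le (sq_nonneg (v 0))]
    rw [aeval_hEv3, map_pow, aeval_hHu, hqD, abs_mul, abs_div, abs_of_nonneg (Real.sqrt_nonneg _),
      abs_of_pos (pow_pos hHv 2)]
    refine mul_le_mul_of_nonneg_right ?_ (Real.sqrt_nonneg _)
    exact (div_le_div_of_nonneg_right hnum (pow_pos hHv 2).le).trans
      (div_le_div_of_nonneg_left (by positivity) (pow_pos hg0 2) hden)
  refine InBaker.of_sub' r (bddRep r.domain r.isSemialgebraic_domain hb _ hfE _ hME) rfl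
    (InBaker.sqrt_const_even E1 hE1 (hEv3 W) (hHu e g ^ 2) _ hQne fun v _ => rfl) ?_
  -- the odd regular part, as a bounded representation on `r.domain`
  have hPne : ∀ v ∈ r.domain, Polynomial.aeval (v 0) (hP e g ^ 2) ≠ 0 := fun v _ => by
    rw [map_pow, aeval_hP]
    exact pow_ne_zero 2 (hH (v 0)).ne'
  have hfO : IsSemialgebraicFunOn ℚ r.domain fun v =>
      v 0 * ((W.coeff 5 : ℝ) * v 0 ^ 4 + (W.coeff 3 : ℝ) * v 0 ^ 2 + (W.coeff 1 : ℝ)) /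
        ((e : ℝ) * v 0 ^ 2 + g) ^ 2 * √(qD 0 0 E1 (v 0)) :=
    ((((IsRatOn.coord.polyAeval (hOd3 W)).div (IsRatOn.coord.polyAeval (hP e g ^ 2))
      hPne).isSemialgebraicFunOn r.isSemialgebraic_domain).mul_holds
        (IsSemialgebraicFunOn.sqrt_holds (isSemialgebraicFunOn_qD 0 0 E1 r.isSemialgebraic_domain))).congr
      fun t _ => by simp only [Pi.mul_apply, aeval_hOd3, map_pow, aeval_hP]
  have hMO : ∀ v ∈ r.domain,
      |v 0 * ((W.coeff 5 : ℝ) * v 0 ^ 4 + (W.coeff 3 : ℝ) * v 0 ^ 2 + (W.coeff 1 : ℝ)) /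
        ((e : ℝ) * v 0 ^ 2 + g) ^ 2 * √(qD 0 0 E1 (v 0))| ≤
        (|(W.coeff 1 : ℝ)| + |(W.coeff 3 : ℝ)| + |(W.coeff 5 : ℝ)|) / (g : ℝ) ^ 2 * √(E1 : ℝ) := by
    intro v hv
    obtain ⟨⟨hx0, hx1⟩, -⟩ := hdom v hv
    have hHv := hH (v 0)
    have hx2 : v 0 ^ 2 ≤ 1 := by nlinarith
    have hq := abs_quad_le (W.coeff 1) (W.coeff 3) (W.coeff 5) (v 0 ^ 2) (sq_nonneg _) hx2
    have hq' : |(W.coeff 5 : ℝ) * v 0 ^ 4 + (W.coeff 3 : ℝ) * v 0 ^ 2 + (W.coeff 1 : ℝ)| ≤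
        |(W.coeff 1 : ℝ)| + |(W.coeff 3 : ℝ)| + |(W.coeff 5 : ℝ)| := by
      rw [show (W.coeff 5 : ℝ) * v 0 ^ 4 + (W.coeff 3 : ℝ) * v 0 ^ 2 + (W.coeff 1 : ℝ) =
        (W.coeff 1 : ℝ) + (W.coeff 3 : ℝ) * v 0 ^ 2 + (W.coeff 5 : ℝ) * (v 0 ^ 2) ^ 2 by ring]
      exact hq
    have hnum : |v 0 * ((W.coeff 5 : ℝ) * v 0 ^ 4 + (W.coeff 3 : ℝ) * v 0 ^ 2 + (W.coeff 1 : ℝ))| ≤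
        |(W.coeff 1 : ℝ)| + |(W.coeff 3 : ℝ)| + |(W.coeff 5 : ℝ)| := by
      rw [abs_mul, abs_of_nonneg hx0]
      calc v 0 * |(W.coeff 5 : ℝ) * v 0 ^ 4 + (W.coeff 3 : ℝ) * v 0 ^ 2 + (W.coeff 1 : ℝ)| ≤
          1 * |(W.coeff 5 : ℝ) * v 0 ^ 4 + (W.coeff 3 : ℝ) * v 0 ^ 2 + (W.coeff 1 : ℝ)| :=
            mul_le_mul_of_nonneg_right hx1 (abs_nonneg _)
        _ ≤ _ := by rw [one_mul]; exact hq'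
    have hden : (g : ℝ) ^ 2 ≤ ((e : ℝ) * v 0 ^ 2 + g) ^ 2 := by
      nlinarith [mul_nonneg he0.le (sq_nonneg (v 0))]
    rw [abs_mul, abs_div, abs_of_nonneg (Real.sqrt_nonneg _), abs_of_pos (pow_pos hHv 2), hqD]
    refine mul_le_mul_of_nonneg_right ?_ (Real.sqrt_nonneg _)
    exact (div_le_div_of_nonneg_right hnum (pow_pos hHv 2).le).trans
      (div_le_div_of_nonneg_left (by positivity) (pow_pos hg0 2) hden)
  refine InBaker.of_sub' _ (bddRep r.domain r.isSemialgebraic_domain hb _ hfO _ hMO) rfl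
    (InBaker.of_Hodd_chart e g E1 (W.coeff 5) (W.coeff 3) (W.coeff 1) he hg hE1 _
      (fun v hv => (hdom v hv).1) fun v _ => rfl) ?_
  -- the residue
  refine InBaker.sqrt_const_pole E1 ρ A hE1 _ fun v hv => ?_
  have hv' : v ∈ r.domain := hv
  have hxρ : v 0 - (ρ : ℝ) ≠ 0 := sub_ne_zero.2 (hdom v hv').2
  have hHne := (hH (v 0)).ne'
  show r.integrand v - Polynomial.aeval (v 0 ^ 2) (hEv3 W) / Polynomial.aeval (v 0 ^ 2) (hHu e g ^ 2) *
      √(qD 0 0 E1 (v 0)) -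
    v 0 * ((W.coeff 5 : ℝ) * v 0 ^ 4 + (W.coeff 3 : ℝ) * v 0 ^ 2 + (W.coeff 1 : ℝ)) /
      ((e : ℝ) * v 0 ^ 2 + g) ^ 2 * √(qD 0 0 E1 (v 0)) = _
  rw [hri hv']
  dsimp only
  rw [map_pow, aeval_hHu, hkey (v 0), aeval_parity5 W hW5 (v 0)]
  field_simp
  ring

end Summit.KontsevichZagierPeriods.RootDecompWalshStrata.ConicDescent.BallCube
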